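import Summits.Langlands.Langlands.Theorems.PicardMuOrdinaryMuOrdinaryFamilyRTPointPlan
import Literature.NumberTheory.GaloisRepresentations.PadicIntermediateFieldIntegers
import Literature.RepresentationTheory.Semisimple.SubrepresentationEquiv

/-!
# The Picard point of line `free-seed-smooth-rt` (crux `MuOrdinaryFamilyRT`, stmt-Langlands-13757):
# preliminaries for LEAF `modelCore` (Carayol–Serre descent)

Helper file for the registered stub `stub_point` (plan: `…PointPlan.lean`).  General lemmas, all PROVED:

* `IsAbsIrreducible.comp_map`, `IsAbsIrreducible.conj`, `glRepresentationConjEquiv`, `eq_conj_comp_of_forall` —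
  absolute irreducibility (the tree's `IsAbsIrreducible`) is stable under extension of scalars along a
  field homomorphism and under conjugation;
* `mem_ker_map_mk_iff`, `conj_sub_one_mem` — `g ∈ ker(ρ mod I)` iff `ρ(g) ≡ 1` entrywise, stable under
  conjugation; `isOpen_preimage_of_isOpen_ker`; `isAdicComplete_field`;
* for a finite `L/ℚ₃` inside `ℚ̄₃` with integers `𝒪_L = intermediateFieldIntegers 3 L`: `isOpen_integers`,
  `isOpen_maximalIdeal_set`, `charP_residueField`, `algebraZModResidueField` (`𝔽₃ → 𝒪_L/𝔪`, a `def`), and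
  **`isAdicContinuous_of_integralModel`**: an integral model `ρ₀ = P⁻¹ ρ P` of a continuous
  `ρ : G → GL_n(L)` is `𝔪`-adically continuous (`ker(ρ₀ mod 𝔪^m)` is the preimage of an open set of
  matrices, `𝔪^m = {‖·‖ ≤ ‖ϖ‖^m}`).
-/

-- `Summit.Langlands.Langlands.…` (summit = sub-problem name, D-0017 layout) trips `dupNamespace` on every decl.
set_option linter.dupNamespace false

namespace Summit.Langlands.Langlands.Cruxes.MuOrdinaryFamilyRT.FreeSeedSmoothRt

open scoped NumberField Polynomial Matrix
open IsLocalRing Metric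
open Literature.NumberTheory.GaloisRepresentations Literature.RepresentationTheory.Semisimple

noncomputable section

/-! ### Absolute irreducibility is stable under field maps and conjugation -/

section AbsIrr

variable {G : Type*} [Group G] {n : ℕ} {k k₂ : Type} [Field k] [Field k₂]

/-- `GL_n(ψ) ∘ GL_n(φ) = GL_n(ψ ∘ φ)` on a homomorphism. -/
theorem generalLinearGroup_map_comp_map {k₃ : Type} [Field k₃] (φ : k →+* k₂) (ψ : k₂ →+* k₃) (σ : G →* GL (Fin n) k) :
    (Matrix.GeneralLinearGroup.map ψ).comp ((Matrix.GeneralLinearGroup.map φ).comp σ) =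
      (Matrix.GeneralLinearGroup.map (ψ.comp φ)).comp σ :=
  MonoidHom.ext fun _ => Units.ext (Matrix.ext fun _ _ => rfl)

/-- Absolute irreducibility is preserved by extension of scalars along a field homomorphism. -/
theorem IsAbsIrreducible.comp_map {σ : G →* GL (Fin n) k} (h : IsAbsIrreducible σ) (φ : k →+* k₂) :
    IsAbsIrreducible ((Matrix.GeneralLinearGroup.map φ).comp σ) := fun k' _ ψ => by
  rw [generalLinearGroup_map_comp_map]
  exact h k' (ψ.comp φ)

/-- The representation on `kⁿ` through a conjugate `P σ P⁻¹` is equivalent to that through `σ`. -/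
def glRepresentationConjEquiv (σ : G →* GL (Fin n) k) (P : GL (Fin n) k) :
    Representation.Equiv (glRepresentation σ) (glRepresentation ((MulAut.conj P).toMonoidHom.comp σ)) :=
  Representation.Equiv.mk (Matrix.GeneralLinearGroup.toLin P).toLinearEquiv fun g => by
    refine LinearMap.ext fun v => ?_
    simp only [LinearMap.comp_apply, MonoidHom.comp_apply, MulEquiv.coe_toMonoidHom, MulAut.conj_apply,
      LinearEquiv.coe_coe]
    change (P : Matrix (Fin n) (Fin n) k) *ᵥ ((σ g : Matrix (Fin n) (Fin n) k) *ᵥ v) =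
      ((P : Matrix (Fin n) (Fin n) k) * (σ g : Matrix (Fin n) (Fin n) k) * ((P⁻¹ : GL (Fin n) k) : Matrix (Fin n) (Fin n) k)) *ᵥ
        ((P : Matrix (Fin n) (Fin n) k) *ᵥ v)
    rw [Matrix.mulVec_mulVec, Matrix.mulVec_mulVec, Matrix.mul_assoc, Matrix.mul_assoc, Units.inv_mul, Matrix.mul_one]

/-- Absolute irreducibility is preserved by conjugation. -/
theorem IsAbsIrreducible.conj {σ : G →* GL (Fin n) k} (h : IsAbsIrreducible σ) (P : GL (Fin n) k) :
    IsAbsIrreducible ((MulAut.conj P).toMonoidHom.comp σ) := fun k' _ ψ => by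
  haveI := h k' ψ
  have heq : (Matrix.GeneralLinearGroup.map ψ).comp ((MulAut.conj P).toMonoidHom.comp σ) =
      (MulAut.conj (Matrix.GeneralLinearGroup.map ψ P)).toMonoidHom.comp ((Matrix.GeneralLinearGroup.map ψ).comp σ) := by
    refine MonoidHom.ext fun g => ?_
    simp only [MonoidHom.comp_apply, MulEquiv.coe_toMonoidHom, MulAut.conj_apply, map_mul, map_inv]
  rw [heq]
  exact Representation.isIrreducible_of_equiv (glRepresentationConjEquiv _ _)

/-- Pointwise conjugate homomorphisms: `(P σ P⁻¹) = conj_P ∘ σ`. -/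
theorem eq_conj_comp_of_forall {σ σ' : G →* GL (Fin n) k} {P : GL (Fin n) k} (h : ∀ g, σ' g = P * σ g * P⁻¹) :
    σ' = (MulAut.conj P).toMonoidHom.comp σ :=
  MonoidHom.ext fun g => by rw [h g]; rfl

end AbsIrr

/-! ### Homomorphisms with open kernel -/

/-- A homomorphism with open kernel pulls back every set to an open set. -/
theorem isOpen_preimage_of_isOpen_ker {G H : Type*} [Group G] [TopologicalSpace G] [IsTopologicalGroup G] [Group H]
    (ρ : G →* H) (hker : IsOpen (ρ.ker : Set G)) (T : Set H) : IsOpen (ρ ⁻¹' T) := by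
  rw [isOpen_iff_forall_mem_open]
  intro g hg
  refine ⟨(fun x => g * x) '' (ρ.ker : Set G), ?_, (Homeomorph.mulLeft g).isOpenMap _ hker, ⟨1, ρ.ker.one_mem, mul_one g⟩⟩
  rintro _ ⟨x, hx, rfl⟩
  rw [Set.mem_preimage, map_mul, (MonoidHom.mem_ker).mp hx, mul_one]
  exact hg

/-! ### Kernels of reduction maps on `GL_n`, and conjugation -/

section Reduction

variable {G : Type*} [Group G] {A : Type*} [CommRing A] {n : Type*} [Fintype n] [DecidableEq n]

/-- `g ∈ ker (ρ mod I)` iff all entries of `ρ(g) - 1` lie in `I`. -/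
theorem mem_ker_map_mk_iff (I : Ideal A) (ρ : G →* GL n A) (g : G) :
    g ∈ ((Matrix.GeneralLinearGroup.map (Ideal.Quotient.mk I)).comp ρ).ker ↔
      ∀ i j, (ρ g).val i j - (1 : Matrix n n A) i j ∈ I := by
  rw [MonoidHom.mem_ker, MonoidHom.comp_apply, Units.ext_iff]
  change (ρ g).val.map (Ideal.Quotient.mk I) = (1 : Matrix n n _) ↔ _
  rw [← Matrix.map_one (Ideal.Quotient.mk I) (map_zero _) (map_one _), ← Matrix.ext_iff]
  refine forall_congr' fun i => forall_congr' fun j => ?_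
  rw [Matrix.map_apply, Matrix.map_apply, Ideal.Quotient.eq]

/-- If `X ≡ 1 (mod I)` entrywise then so is `P⁻¹ X P`. -/
theorem conj_sub_one_mem (I : Ideal A) (X P : GL n A) (hX : ∀ i j, X.val i j - (1 : Matrix n n A) i j ∈ I) :
    ∀ i j, (P⁻¹ * X * P).val i j - (1 : Matrix n n A) i j ∈ I := by
  intro i j
  have key : (P⁻¹ * X * P).val - 1 = (P⁻¹).val * (X.val - 1) * P.val := by
    rw [Units.val_mul, Units.val_mul, Matrix.mul_sub, Matrix.sub_mul, Matrix.mul_one, Units.inv_mul]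
  have h := congrArg (fun M : Matrix n n A => M i j) key
  simp only [Matrix.sub_apply] at h
  rw [h, Matrix.mul_apply]
  refine I.sum_mem fun l _ => I.mul_mem_right _ ?_
  rw [Matrix.mul_apply]
  exact I.sum_mem fun k _ => I.mul_mem_left _ (by simpa [Matrix.sub_apply] using hX k l)

end Reduction

/-! ### Fields are adically complete -/

/-- A field is complete for its (zero) maximal ideal. -/
theorem isAdicComplete_field (k : Type*) [Field k] : IsAdicComplete (maximalIdeal k) k := by
  rw [maximalIdeal_eq_bot]; infer_instance

/-! ### The integers of a finite extension of `ℚ₃` inside `ℚ̄₃`: openness, residue characteristic -/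

section Integers

variable (L : IntermediateField ℚ_[3] (PadicAlgCl 3))

/-- The unit ball `𝒪_L ⊆ L` is open. -/
theorem isOpen_integers : IsOpen ((intermediateFieldIntegers 3 L : Set L)) := by
  have : ((intermediateFieldIntegers 3 L : Set L)) = closedBall (0 : L) 1 := by
    ext x
    rw [SetLike.mem_coe, intermediateFieldIntegers.mem_iff_norm_le_one, mem_closedBall, dist_zero_right]
  rw [this]
  exact IsUltrametricDist.isOpen_closedBall _ one_ne_zero

/-- The maximal ideal of `𝒪_L`, as a subset of `L`, is open. -/
theorem isOpen_maximalIdeal_set :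
    IsOpen {x : L | ∃ h : x ∈ intermediateFieldIntegers 3 L, (⟨x, h⟩ : intermediateFieldIntegers 3 L) ∈
      maximalIdeal (intermediateFieldIntegers 3 L)} := by
  have : {x : L | ∃ h : x ∈ intermediateFieldIntegers 3 L, (⟨x, h⟩ : intermediateFieldIntegers 3 L) ∈
      maximalIdeal (intermediateFieldIntegers 3 L)} = ball (0 : L) 1 := by
    ext x
    simp only [Set.mem_setOf_eq, mem_ball, dist_zero_right, intermediateFieldIntegers.mem_maximalIdeal_iff]
    constructor
    · rintro ⟨-, h⟩; exact h
    · intro h; exact ⟨(intermediateFieldIntegers.mem_iff_norm_le_one L x).mpr h.le, h⟩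
  rw [this]
  exact isOpen_ball

/-- The residue field of `𝒪_L` has characteristic `3` (a theorem, used via `haveI`, not an instance on
the library type). -/
theorem charP_residueField : CharP (ResidueField (intermediateFieldIntegers 3 L)) 3 := by
  refine (CharP.charP_iff_prime_eq_zero Nat.prime_three).mpr ?_
  rw [← map_natCast (residue (intermediateFieldIntegers 3 L)) 3, residue_eq_zero_iff]
  exact intermediateFieldIntegers.natCast_mem_maximalIdeal L

/-- `𝔽₃ → 𝒪_L/𝔪_L` (a `def`, turned on with `letI`). -/
abbrev algebraZModResidueField : Algebra (ZMod 3) (ResidueField (intermediateFieldIntegers 3 L)) :=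
  haveI := charP_residueField L
  ZMod.algebra _ 3

variable [FiniteDimensional ℚ_[3] L]

/-- **Integral models of continuous representations are `𝔪`-adically continuous**: if
`ρ₀ : G → GL_n(𝒪_L)` satisfies `ρ₀(g) = P⁻¹ ρ(g) P` for a continuous `ρ : G → GL_n(L)`, then every
`ker (ρ₀ mod 𝔪^m)` is open. -/
theorem isAdicContinuous_of_integralModel {G : Type*} [Group G] [TopologicalSpace G] [IsTopologicalGroup G] {n : ℕ}
    {ρ : G →ₜ* GL (Fin n) L} {P : GL (Fin n) L} {ρ₀ : G →* GL (Fin n) (intermediateFieldIntegers 3 L)}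
    (h : ∀ g, Matrix.GeneralLinearGroup.map (intermediateFieldIntegers 3 L).subtype (ρ₀ g) = P⁻¹ * ρ g * P) :
    Deformation.IsAdicContinuous ρ₀ := by
  intro m
  have hr0 : ‖(intermediateFieldIntegers.uniformizer L : L)‖ ^ m ≠ 0 :=
    pow_ne_zero _ (intermediateFieldIntegers.norm_uniformizer_pos L).ne'
  -- the open set of matrices with all entries of norm `≤ ‖ϖ‖^m`
  have hSo : IsOpen {M : Matrix (Fin n) (Fin n) L | ∀ i j, ‖M i j‖ ≤ ‖(intermediateFieldIntegers.uniformizer L : L)‖ ^ m} := by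
    have : {M : Matrix (Fin n) (Fin n) L | ∀ i j, ‖M i j‖ ≤ ‖(intermediateFieldIntegers.uniformizer L : L)‖ ^ m} =
        ⋂ i, ⋂ j, (fun M : Matrix (Fin n) (Fin n) L => M i j) ⁻¹'
          closedBall (0 : L) (‖(intermediateFieldIntegers.uniformizer L : L)‖ ^ m) := by
      ext M; simp [mem_closedBall, dist_zero_right]
    rw [this]
    exact isOpen_iInter_of_finite fun i => isOpen_iInter_of_finite fun j =>
      (IsUltrametricDist.isOpen_closedBall _ hr0).preimage (continuous_id.matrix_elem i j)
  -- entries of `ρ₀ g` in `L`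
  have hcoe : ∀ g i j, (((ρ₀ g).val i j : intermediateFieldIntegers 3 L) : L) -
      (((1 : Matrix (Fin n) (Fin n) (intermediateFieldIntegers 3 L)) i j : intermediateFieldIntegers 3 L) : L) =
        (((P⁻¹ * ρ g * P : GL (Fin n) L) : Matrix (Fin n) (Fin n) L) - 1) i j := by
    intro g i j
    have h1 : (((ρ₀ g).val i j : intermediateFieldIntegers 3 L) : L) =
        ((Matrix.GeneralLinearGroup.map (intermediateFieldIntegers 3 L).subtype (ρ₀ g) : GL (Fin n) L) :
          Matrix (Fin n) (Fin n) L) i j := rfl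
    rw [h1, h g, Matrix.sub_apply]
    congr 1
    by_cases hij : i = j
    · subst hij; simp
    · simp [Matrix.one_apply_ne hij]
  -- the kernel is the preimage of that open set under the continuous `g ↦ P⁻¹ ρ(g) P - 1`
  have hker : ((((Matrix.GeneralLinearGroup.map (Ideal.Quotient.mk (maximalIdeal (intermediateFieldIntegers 3 L) ^ m))).comp ρ₀).ker :
      Subgroup G) : Set G) =
      (fun g => (((P⁻¹ * ρ g * P : GL (Fin n) L) : Matrix (Fin n) (Fin n) L) - 1)) ⁻¹'
        {M : Matrix (Fin n) (Fin n) L | ∀ i j, ‖M i j‖ ≤ ‖(intermediateFieldIntegers.uniformizer L : L)‖ ^ m} := by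
    ext g
    simp only [SetLike.mem_coe, MonoidHom.mem_ker, MonoidHom.comp_apply, Set.mem_preimage, Set.mem_setOf_eq]
    rw [Units.ext_iff]
    change (ρ₀ g).val.map (Ideal.Quotient.mk (maximalIdeal (intermediateFieldIntegers 3 L) ^ m)) =
      (1 : Matrix (Fin n) (Fin n) _) ↔ _
    rw [← Matrix.map_one (Ideal.Quotient.mk (maximalIdeal (intermediateFieldIntegers 3 L) ^ m)) (map_zero _) (map_one _),
      ← Matrix.ext_iff]
    refine forall_congr' fun i => forall_congr' fun j => ?_
    rw [Matrix.map_apply, Matrix.map_apply, Ideal.Quotient.eq, intermediateFieldIntegers.mem_maximalIdeal_pow_iff,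
      AddSubgroupClass.coe_sub, hcoe]
  rw [hker]
  exact hSo.preimage ((Units.continuous_val.comp ((continuous_const.mul ρ.continuous_toFun).mul continuous_const)).sub
    continuous_const)

end Integers

/-- **Summary (registered helper goal of `stub_point`)**: integral models of continuous representations over
the integers of a finite extension of `ℚ₃` in `ℚ̄₃` are `𝔪`-adically continuous. -/
theorem pointDescentPrelim_isAdicContinuous : ∀ (L : IntermediateField ℚ_[3] (PadicAlgCl 3)) [FiniteDimensional ℚ_[3] L] {G : Type} [Group G] [TopologicalSpace G] [IsTopologicalGroup G] {n : ℕ} (ρ : G →ₜ* GL (Fin n) L) (P : GL (Fin n) L) (ρ₀ : G →* GL (Fin n) (intermediateFieldIntegers 3 L)), (∀ g, Matrix.GeneralLinearGroup.map (intermediateFieldIntegers 3 L).subtype (ρ₀ g) = P⁻¹ * ρ g * P) → Deformation.IsAdicContinuous ρ₀ :=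
  fun L _ _ _ _ _ _ _ _ _ h => isAdicContinuous_of_integralModel L h

end

end Summit.Langlands.Langlands.Cruxes.MuOrdinaryFamilyRT.FreeSeedSmoothRt
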